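import Summits.BirchSwinnertonDyer.BirchSwinnertonDyer.Theorems.PrintCf2SplitBadTwoDyadicTorsion
import HarnessLib

set_option linter.dupNamespace false -- `…BirchSwinnertonDyer.BirchSwinnertonDyer…` is the cell's namespace (D-0017)
set_option autoImplicit false

/-!
# The DYADIC TORSION TABLE of the split-bad class, II: the class `d ≡ 3 (mod 8)` —
# `W_d(ℚ₂)[2^∞] ≅ ℤ/4 × ℤ/2` (`t = 3`) for `W_d : y² = x³ + 21d·x² + 112d²·x` (`= 49a1^{(d)}`)

Cell `bsd-print-cf2`, width seat `bsd-line-cf2-p1-w4` g6 (`--supports stmt-BirchSwinnertonDyer-20368`, crux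
`PrintCf2.SplitBadTwoRankOneOfFacts`, road α, skeleton of record v8). Theses-free; theorems only; no `sorry`. HONEST
FRAMING: elementary 2-adic arithmetic of an explicit family of Weierstrass equations; nothing about `L`-values; BSD is not
proved by any of this and no summit statement is proved by this seat.

Sibling of `…PrintCf2SplitBadTwoDyadicTorsion` (the five classes with `t = 2`). Here `u ≡ 3 (mod 8)` (key `(1,3)`,
anchor `d₀ = −5`): with `s = √−7 = 53 + 128r ∈ ℤ₂` (Hensel's root pinned through `s² = −7`), the two-torsion point
`T₋ = (x₋, 0)`, `x₋ = (−21u − us)/2 = −u(37 + 64r)`, IS halvable over `ℚ₂`: on the model translated by `x₋`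
(`y² = x³ + Ax² + Bx`, `A = −u(90 + 192r)`, `B = u²(553 + 1344r)`) the point `Q = (β, βw)` with `β² = B`
(`β = u(3 + 16j)`) and `w² = A + 2β = 4u(−21 − 48r + 8j) ∈ 4(1 + 8ℤ₂)` doubles to `(0,0)` (the tangent at `Q` has
slope `w`). Conversely every `P` with `2P = T₋` has `(x(P) − x₋)² = B`, so `x(P) = x₋ ± β ∈ {2·unit, 8·unit}` is NOT a
square in `ℚ₂` and `P ∉ 2V(ℚ₂)`: no point of order `8` (`T₀`, `T₊` are not halvable: `7 ∉ ℚ₂²`, `x₊ − x₋ = us ≡ 7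
(mod 8)`). The count `#V(ℚ₂)[2^∞] = 8` and the log-image corollary (`log_ω(W(ℚ₂)) = 2^{t − v₂ c₂}ℤ₂ = 2ℤ₂` on this
class versus `ℤ₂` on the other five, tree b2b-bsdres + bsd-goldfeld `c₂ = 4`) are assembled in the next sibling.
References: [SilvermanTate2015] §3.5; [SilvermanAEC2009] III.2.3 (group law), X.1; [Serre1973] Ch. II §3.3 Thm 4.
-/


noncomputable section

open scoped Classical

open WeierstrassCurve Literature.NumberTheory.QuadraticForms

namespace Summit.BirchSwinnertonDyer.BirchSwinnertonDyer.Theorems.PrintCf2.DyadicTorsion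

/-! ## §1 Doubling onto `T = (0,0)` on `y² = x³ + ax² + bx` (any field) -/

section Doubling

variable {F : Type*} [Field F] (V : WeierstrassCurve F) [V.IsTwoTorsionNF] [V.IsElliptic]

/-- **The explicit half of `T`.** If `x₀² = b` and `w² = a + 2x₀` with `x₀ w ≠ 0`, then `Q = (x₀, x₀w)` lies on
`y² = x³ + ax² + bx` and `2Q = T = (0,0)`: the tangent at `Q` has slope `(3x₀² + 2ax₀ + b)/(2x₀w) = w`, so
`x(2Q) = w² − a − 2x₀ = 0`. [cite: SilvermanAEC2009, Group Law Algorithm III.2.3] -/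
theorem two_nsmul_eq_twoTorsionPoint_of_sq {x₀ w : F} (hx : x₀ ^ 2 = V.a₄) (hw : w ^ 2 = V.a₂ + 2 * x₀)
    (hx0 : x₀ ≠ 0) (hw0 : w ≠ 0) :
    ∃ h : V.toAffine.Nonsingular x₀ (x₀ * w), 2 • (Affine.Point.some x₀ (x₀ * w) h) = V.twoTorsionPoint := by
  have heq : V.toAffine.Equation x₀ (x₀ * w) := by
    rw [equation_iff_of_isTwoTorsionNF]
    linear_combination x₀ ^ 2 * hw + x₀ * hx
  have h : V.toAffine.Nonsingular x₀ (x₀ * w) := Affine.equation_iff_nonsingular.mp heq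
  refine ⟨h, ?_⟩
  have h2 := two_ne_zero' V
  have hy : x₀ * w ≠ V.toAffine.negY x₀ (x₀ * w) := by
    rw [negY_of_isTwoTorsionNF]
    intro e
    have : (2 : F) * (x₀ * w) = 0 := by linear_combination e
    exact mul_ne_zero h2 (mul_ne_zero hx0 hw0) this
  have hL : V.toAffine.slope x₀ x₀ (x₀ * w) (x₀ * w) = w := by
    rw [Affine.slope_of_Y_ne rfl hy, negY_of_isTwoTorsionNF, a₁_of_isTwoTorsionNF]
    have hden : x₀ * w - -(x₀ * w) ≠ 0 := by
      intro e
      have : (2 : F) * (x₀ * w) = 0 := by linear_combination e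
      exact mul_ne_zero h2 (mul_ne_zero hx0 hw0) this
    rw [div_eq_iff hden]
    linear_combination -hx - 2 * x₀ * hw
  rw [two_nsmul, Affine.Point.add_self_of_Y_ne hy]
  simp only [twoTorsionPoint, Affine.Point.some.injEq]
  have hX : V.toAffine.addX x₀ x₀ (V.toAffine.slope x₀ x₀ (x₀ * w) (x₀ * w)) = 0 := by
    rw [hL, Affine.addX, toAffine_a₁, toAffine_a₂, a₁_of_isTwoTorsionNF]
    linear_combination hw
  refine ⟨hX, ?_⟩
  rw [Affine.addY, Affine.negAddY, hX, negY_of_isTwoTorsionNF, hL]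
  ring

/-- **Conversely**: if `2·(x, y) = T = (0,0)` on `y² = x³ + ax² + bx` then `x² = b`. (From the doubling formulas:
`y(2Q) = 0` forces the tangent slope `y/x`, and `x(2Q) = 0` then reads `y² = x²(a + 2x)`, i.e. `bx = x³`.)
[cite: SilvermanAEC2009, Group Law Algorithm III.2.3] -/
theorem sq_eq_a₄_of_two_nsmul_eq_twoTorsionPoint {x y : F} {h : V.toAffine.Nonsingular x y}
    (hQ : 2 • (Affine.Point.some x y h) = V.twoTorsionPoint) : x ^ 2 = V.a₄ := by
  have h2 := two_ne_zero' V
  have hy0 : y ≠ 0 := by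
    intro hy
    have : 2 • (Affine.Point.some x y h) = 0 := (V.two_nsmul_eq_zero_iff_y_eq_zero h).mpr hy
    rw [this] at hQ
    exact Affine.Point.some_ne_zero _ hQ.symm
  have hx0 : x ≠ 0 := fun hx => hy0 (y_eq_zero_of_x_eq_zero V h hx)
  have hy : y ≠ V.toAffine.negY x y := by
    rw [negY_of_isTwoTorsionNF]
    intro e
    have : (2 : F) * y = 0 := by linear_combination e
    exact mul_ne_zero h2 hy0 this
  have e := rel_of_nonsingular V h
  rw [two_nsmul, Affine.Point.add_self_of_Y_ne hy] at hQ
  simp only [twoTorsionPoint, Affine.Point.some.injEq] at hQ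
  obtain ⟨hX, hY⟩ := hQ
  set L := V.toAffine.slope x x y y with hL
  rw [Affine.addY, Affine.negAddY, hX, negY_of_isTwoTorsionNF] at hY
  rw [Affine.addX, toAffine_a₁, toAffine_a₂, a₁_of_isTwoTorsionNF] at hX
  have hLx : L * x = y := by linear_combination hY
  have hL2 : L ^ 2 = V.a₂ + 2 * x := by linear_combination hX
  have key : y ^ 2 = x ^ 2 * (V.a₂ + 2 * x) := by
    linear_combination (-(y + L * x)) * hLx + x ^ 2 * hL2
  have : x * (x ^ 2 - V.a₄) = 0 := by linear_combination e - key
  exact sub_eq_zero.mp ((mul_eq_zero.mp this).resolve_left hx0)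

end Doubling

/-! ## §2 The root `s = 53 + 128r` of `s² = −7` and the 2-adic unit bookkeeping -/

section TwoAdic

/-- Numerals commute with the coercion `ℤ₂ → ℚ₂` (for `push_cast`). [folklore] -/
@[simp, norm_cast]
theorem coe_ofNat (n : ℕ) [n.AtLeastTwo] : ((ofNat(n) : ℤ_[2]) : ℚ_[2]) = ofNat(n) :=
  map_ofNat (PadicInt.Coe.ringHom (p := 2)) n

/-- `553 + 1344ρ = 1` in `ℤ/8`. [folklore] -/
theorem zmod8_B₁ : ∀ ρ : ZMod 8, (553 : ZMod 8) + 1344 * ρ = 1 := by decide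

/-- `(8κ + 3)(−21 − 48ρ + 8ι) = 1` in `ℤ/8`. [folklore] -/
theorem zmod8_c₁ : ∀ ρ ι κ : ZMod 8, ((8 : ZMod 8) * κ + 3) * (-21 - 48 * ρ + 8 * ι) = 1 := by decide

/-- `(8κ + 3)(53 + 128ρ) = 7` is not a square in `ℤ/8`. [folklore] -/
theorem zmod8_us : ∀ (ρ κ x : ZMod 8), x ^ 2 ≠ ((8 : ZMod 8) * κ + 3) * (53 + 128 * ρ) := by decide

/-- `553 + 1344 r ≡ 1 (mod 8)`. [folklore] -/
theorem toZModPow_three_B₁ (r : ℤ_[2]) : PadicInt.toZModPow 3 ((553 : ℤ_[2]) + 1344 * r) = 1 := by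
  rw [map_add, map_mul, map_ofNat, map_ofNat]
  exact zmod8_B₁ _

/-- `u(−21 − 48r + 8j) ≡ 3·(−21) ≡ 1 (mod 8)` for `u ≡ 3 (mod 8)`. [folklore] -/
theorem toZModPow_three_c₁ {u : ℤ} (hu : u % 8 = 3) (r j : ℤ_[2]) :
    PadicInt.toZModPow 3 ((u : ℤ_[2]) * (-21 - 48 * r + 8 * j)) = 1 := by
  obtain ⟨q, rfl⟩ : ∃ q : ℤ, u = 8 * q + 3 := ⟨u / 8, by omega⟩
  have hu' : ((8 * q + 3 : ℤ) : ℤ_[2]) = 8 * (q : ℤ_[2]) + 3 := by push_cast; ring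
  rw [hu', map_mul, map_add, map_mul, map_ofNat, map_ofNat, map_add, map_sub, map_neg, map_mul, map_mul, map_ofNat,
    map_ofNat, map_ofNat]
  exact zmod8_c₁ _ _ _

/-- `u·s ≡ 3·5 ≡ 7 (mod 8)` is not a square mod `8`, for `u ≡ 3 (mod 8)` and `s = 53 + 128r`. [folklore] -/
theorem forall_sq_ne_toZModPow_three_us {u : ℤ} (hu : u % 8 = 3) {s r : ℤ_[2]} (hsr : s = (53 : ℤ) + 128 * r) :
    ∀ x : ZMod (2 ^ 3), x ^ 2 ≠ PadicInt.toZModPow 3 ((u : ℤ_[2]) * s) := by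
  obtain ⟨q, rfl⟩ : ∃ q : ℤ, u = 8 * q + 3 := ⟨u / 8, by omega⟩
  have hu' : ((8 * q + 3 : ℤ) : ℤ_[2]) = 8 * (q : ℤ_[2]) + 3 := by push_cast; ring
  have hsr' : s = 53 + 128 * r := by rw [hsr]; push_cast; ring
  rw [hu', hsr', map_mul, map_add, map_mul, map_ofNat, map_ofNat, map_add, map_mul, map_ofNat, map_ofNat]
  intro x
  exact zmod8_us _ _ x

/-- `n + 2k` is a unit of `ℤ₂` for `n` an odd integer and any `k ∈ ℤ₂`. [folklore] -/
theorem isUnit_intCast_add_two_mul {n : ℤ} (hn : Odd n) (k : ℤ_[2]) : IsUnit ((n : ℤ_[2]) + 2 * k) := by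
  rw [PadicInt.isUnit_iff]
  have h1 : ‖(n : ℤ_[2])‖ = 1 := norm_intCast_eq_one_of_odd hn
  have h2 : ‖(2 : ℤ_[2]) * k‖ < 1 := by
    rw [norm_mul]
    have h2' : ‖(2 : ℤ_[2])‖ = (2 : ℝ)⁻¹ := by exact_mod_cast PadicInt.norm_p (p := 2)
    rw [h2']
    have := PadicInt.norm_le_one k
    have hk : 0 ≤ ‖k‖ := norm_nonneg _
    nlinarith
  have hne : ‖(n : ℤ_[2])‖ ≠ ‖(2 : ℤ_[2]) * k‖ := by rw [h1]; exact (ne_of_lt h2).symm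
  rw [PadicInt.norm_add_eq_max_of_ne hne, h1]
  exact max_eq_left (le_of_lt (h1 ▸ h2))

/-- `2ⁿ · (unit)` with `n` odd is not a square in `ℚ₂`. [cite: Serre1973, Ch. II §3.3 Thm 4] -/
theorem not_isSquare_two_zpow_mul_coe_of_isUnit {n : ℤ} (hn : Odd n) {v : ℤ_[2]} (hv : IsUnit v) :
    ¬ IsSquare ((2 : ℚ_[2]) ^ n * ((v : ℤ_[2]) : ℚ_[2])) := by
  obtain ⟨v, rfl⟩ := hv
  intro h
  exact (Int.not_even_iff_odd.mpr hn) ((padic_two_isSquare_zpow_mul_unit_iff v n).mp h).1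

/-- An element of `ℤ₂` with residue `c mod 2ⁿ` is `c + 2ⁿ k`. [folklore] -/
theorem exists_eq_add_pow_mul_of_toZModPow_eq {z : ℤ_[2]} {n : ℕ} {c : ℤ}
    (h : PadicInt.toZModPow n z = (c : ZMod (2 ^ n))) : ∃ k : ℤ_[2], z = c + 2 ^ n * k := by
  have hmem : z - c ∈ RingHom.ker (PadicInt.toZModPow n : ℤ_[2] →+* ZMod (2 ^ n)) := by
    rw [RingHom.mem_ker, map_sub, map_intCast, h, sub_self]
  rw [PadicInt.ker_toZModPow, Ideal.mem_span_singleton'] at hmem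
  obtain ⟨k, hk⟩ := hmem
  exact ⟨k, by rw [← sub_eq_iff_eq_add', ← hk]; push_cast; ring⟩

/-- **The root `s ≡ 5 (mod 8)` of `−7`, to precision `2⁷`: there is `s ∈ ℤ₂` with `s² = −7` and `s = 53 + 128r`**
(hence `s ≡ 181 (mod 256)`; `r` satisfies `64r² + 53r + 11 = 0`). Proof: Hensel gives a root `s₀`; `s₀` or `−s₀`
is `≡ 1 (mod 4)`; then `s² = −7` pins `s ≡ 5 (16)`, `≡ 53 (128)` by three division steps.
[cite: Serre1973, Ch. II §3.3 Thm 4] -/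
theorem exists_sq_eq_neg_seven_fine : ∃ s r : ℤ_[2], s ^ 2 = -7 ∧ s = (53 : ℤ) + 128 * r := by
  obtain ⟨s₀, hs₀⟩ := GoldfeldGoodTwists.exists_padicInt_two_sq_eq_neg_seven
  obtain ⟨s, hs, h4⟩ : ∃ s : ℤ_[2], s ^ 2 = -7 ∧ PadicInt.toZModPow 2 s = ((1 : ℤ) : ZMod (2 ^ 2)) := by
    have hsq : (PadicInt.toZModPow 2 s₀) ^ 2 = -7 := by rw [← map_pow, hs₀, map_neg, map_ofNat]
    have hcases : ∀ x : ZMod (2 ^ 2), x ^ 2 = -7 → x = 1 ∨ -x = 1 := by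
      rw [show (2 : ℕ) ^ 2 = 4 by norm_num]; decide
    rcases hcases _ hsq with h | h
    · exact ⟨s₀, hs₀, by rw [h, Int.cast_one]⟩
    · exact ⟨-s₀, by rw [neg_sq, hs₀], by rw [map_neg, h, Int.cast_one]⟩
  obtain ⟨k, hk⟩ := exists_eq_add_pow_mul_of_toZModPow_eq h4
  have e0 : 2 * k ^ 2 + k + 1 = 0 := by
    have h' : ((1 : ℤ) + 2 ^ 2 * k : ℤ_[2]) ^ 2 = -7 := by rw [← hk]; exact hs
    have : (8 : ℤ_[2]) * (2 * k ^ 2 + k + 1) = 8 * 0 := by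
      rw [mul_zero]; push_cast at h'; linear_combination h'
    exact mul_left_cancel₀ (by norm_num) this
  set k₁ : ℤ_[2] := -1 - k ^ 2 with hk₁
  have e1 : k = 1 + 2 * k₁ := by rw [hk₁]; linear_combination e0
  have e1' : 4 * k₁ ^ 2 + 5 * k₁ + 2 = 0 := by
    have h' := e0
    rw [e1] at h'
    have : (2 : ℤ_[2]) * (4 * k₁ ^ 2 + 5 * k₁ + 2) = 2 * 0 := by rw [mul_zero]; linear_combination h'
    exact mul_left_cancel₀ (by norm_num) this
  set k₂ : ℤ_[2] := -1 - 2 * k₁ ^ 2 - 2 * k₁ with hk₂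
  have e2 : k₁ = 2 * k₂ := by rw [hk₂]; linear_combination e1'
  have e2' : 8 * k₂ ^ 2 + 5 * k₂ + 1 = 0 := by
    have h' := e1'
    rw [e2] at h'
    have : (2 : ℤ_[2]) * (8 * k₂ ^ 2 + 5 * k₂ + 1) = 2 * 0 := by rw [mul_zero]; linear_combination h'
    exact mul_left_cancel₀ (by norm_num) this
  set k₃ : ℤ_[2] := 2 * k₂ + 3 * k₂ ^ 2 with hk₃
  have e3 : k₂ = 3 + 8 * k₃ := by rw [hk₃]; linear_combination (-3) * e2'
  exact ⟨s, k₃, hs, by rw [hk, e1, e2, e3]; push_cast; ring⟩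

end TwoAdic

/-! ## §3 The class `u ≡ 3 (mod 8)`: `T₋` is halvable, nothing has order `8`, `#V(ℚ₂)[2^∞] = 8` -/

section Family

variable (V : WeierstrassCurve ℚ_[2]) [V.IsTwoTorsionNF] [V.IsElliptic] {u : ℤ}
  (ha : V.a₂ = 21 * (u : ℚ_[2])) (hb : V.a₄ = 112 * (u : ℚ_[2]) ^ 2)

omit [V.IsElliptic] in
include ha hb in
/-- The translated model at `T₋`: with `s = 53 + 128r`, `s² = −7`, `x₋ = (−21u − us)/2 = −u(37 + 64r)` and
`C = ⟨1, x₋, 0, 0⟩`: `a₂(C • V) = −u(90 + 192r)` and `a₄(C • V) = u²(553 + 1344r)`. [cite: SilvermanAEC2009, III.1 Table 3.1] -/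
theorem smul_root_coeffs {s r : ℤ_[2]} (hs : s ^ 2 = -7) (hsr : s = (53 : ℤ) + 128 * r) :
    (-21 * (u : ℚ_[2]) - u * s) / 2 = -(u : ℚ_[2]) * (37 + 64 * r) ∧
    ((⟨1, (-21 * (u : ℚ_[2]) - u * s) / 2, 0, 0⟩ : VariableChange ℚ_[2]) • V).a₂ =
        -(u : ℚ_[2]) * (90 + 192 * r) ∧
    ((⟨1, (-21 * (u : ℚ_[2]) - u * s) / 2, 0, 0⟩ : VariableChange ℚ_[2]) • V).a₄ =
        (u : ℚ_[2]) ^ 2 * (553 + 1344 * r) := by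
  have hsr' : (s : ℚ_[2]) = 53 + 128 * r := by rw [hsr]; push_cast; ring
  have hR : (64 : ℚ_[2]) * r ^ 2 + 53 * r + 11 = 0 := by
    have h' : ((s : ℚ_[2])) ^ 2 = -7 := by exact_mod_cast congrArg ((↑) : ℤ_[2] → ℚ_[2]) hs
    rw [hsr'] at h'
    linear_combination h' / 256
  have hx : (-21 * (u : ℚ_[2]) - u * s) / 2 = -(u : ℚ_[2]) * (37 + 64 * r) := by
    rw [hsr']; ring
  refine ⟨hx, ?_, ?_⟩
  · rw [smul_root_a₂, hx, ha]; ring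
  · rw [smul_root_a₄, hx, ha, hb]; linear_combination (192 * (u : ℚ_[2]) ^ 2) * hR

/-- `√(553 + 1344r)` pinned: there is `β₁ ∈ ℤ₂` with `β₁² = 553 + 1344r` and `β₁ = 3 + 16j` (Hensel, the sign with
`β₁ ≡ 3 (mod 4)`, then two division steps through `β₁² = 553 + 1344r`). [cite: Serre1973, Ch. II §3.3 Thm 4] -/
theorem exists_sqrt_B₁ (r : ℤ_[2]) : ∃ β₁ j : ℤ_[2], β₁ ^ 2 = 553 + 1344 * r ∧ β₁ = (3 : ℤ) + 16 * j := by
  obtain ⟨β₀, hβ₀⟩ : IsSquare ((553 : ℤ_[2]) + 1344 * r) :=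
    padicInt_isSquare_of_toZModPow_three_eq_one (toZModPow_three_B₁ r)
  obtain ⟨β₁, hβ₁, hβ4⟩ : ∃ β₁ : ℤ_[2], β₁ ^ 2 = 553 + 1344 * r ∧
      PadicInt.toZModPow 2 β₁ = ((3 : ℤ) : ZMod (2 ^ 2)) := by
    have hsq : (PadicInt.toZModPow 2 β₀) ^ 2 = 553 + 1344 * PadicInt.toZModPow 2 r := by
      rw [← map_pow, show β₀ ^ 2 = β₀ * β₀ from sq β₀, ← hβ₀, map_add, map_mul, map_ofNat, map_ofNat]
    have hcases : ∀ x y : ZMod (2 ^ 2), x ^ 2 = 553 + 1344 * y → x = 3 ∨ -x = 3 := by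
      rw [show (2 : ℕ) ^ 2 = 4 by norm_num]; decide
    rcases hcases _ _ hsq with h | h
    · exact ⟨β₀, by rw [show β₀ ^ 2 = β₀ * β₀ from sq β₀]; exact hβ₀.symm, by rw [h, Int.cast_ofNat]⟩
    · exact ⟨-β₀, by rw [neg_sq, show β₀ ^ 2 = β₀ * β₀ from sq β₀]; exact hβ₀.symm, by rw [map_neg, h, Int.cast_ofNat]⟩
  obtain ⟨m, hmβ⟩ := exists_eq_add_pow_mul_of_toZModPow_eq hβ4
  have f0 : 2 * m ^ 2 + 3 * m - 68 - 168 * r = 0 := by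
    have h' : ((3 : ℤ) + 2 ^ 2 * m : ℤ_[2]) ^ 2 = 553 + 1344 * r := by rw [← hmβ]; exact hβ₁
    have : (8 : ℤ_[2]) * (2 * m ^ 2 + 3 * m - 68 - 168 * r) = 8 * 0 := by
      rw [mul_zero]; push_cast at h'; linear_combination h'
    exact mul_left_cancel₀ (by norm_num) this
  set m₁ : ℤ_[2] := 34 + 84 * r - m ^ 2 - m with hm₁
  have f1 : m = 2 * m₁ := by rw [hm₁]; linear_combination f0
  have f1' : 4 * m₁ ^ 2 + 3 * m₁ - 34 - 84 * r = 0 := by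
    have h' := f0
    rw [f1] at h'
    have : (2 : ℤ_[2]) * (4 * m₁ ^ 2 + 3 * m₁ - 34 - 84 * r) = 2 * 0 := by rw [mul_zero]; linear_combination h'
    exact mul_left_cancel₀ (by norm_num) this
  set j : ℤ_[2] := 17 + 42 * r - 2 * m₁ ^ 2 - m₁ with hj
  have f2 : m₁ = 2 * j := by rw [hj]; linear_combination f1'
  exact ⟨β₁, j, hβ₁, by rw [hmβ, f1, f2]; push_cast; ring⟩

include ha hb in
/-- **`T₋` IS HALVABLE for `u ≡ 3 (mod 8)`**: with `s = 53 + 128r` (`s² = −7`), there is `Q ∈ V(ℚ₂)` with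
`2Q = T₋ = ((−21u − us)/2, 0)`; in particular `Q` has order `4`. [cite: SilvermanAEC2009, Group Law Algorithm III.2.3]
[cite: Serre1973, Ch. II §3.3 Thm 4] -/
theorem exists_two_nsmul_eq_Tminus (hu : u % 8 = 3) {s r : ℤ_[2]} (hs : s ^ 2 = -7)
    (hsr : s = (53 : ℤ) + 128 * r) (hm : V.toAffine.Nonsingular ((-21 * (u : ℚ_[2]) - u * s) / 2) 0) :
    ∃ Q : V.toAffine.Point, 2 • Q = .some _ 0 hm := by
  obtain ⟨hx, hA, hB⟩ := smul_root_coeffs V ha hb hs hsr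
  set xm : ℚ_[2] := (-21 * (u : ℚ_[2]) - u * s) / 2 with hxm
  set C : VariableChange ℚ_[2] := ⟨1, xm, 0, 0⟩ with hC
  have hu0 : (u : ℚ_[2]) ≠ 0 := by exact_mod_cast (show u ≠ 0 by omega)
  have hs' : ((s : ℚ_[2])) ^ 2 = -7 := by exact_mod_cast congrArg ((↑) : ℤ_[2] → ℚ_[2]) hs
  obtain ⟨hsum, hprod⟩ := roots_of_sq_eq V ha hb hs'
  obtain ⟨-, hrm⟩ := root_of_sum_prod V hsum hprod
  haveI : (C • V).IsTwoTorsionNF := isTwoTorsionNF_smul_of_root V (by linear_combination xm * hrm)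
  obtain ⟨β₁, j, hβ₁, hβj⟩ := exists_sqrt_B₁ r
  obtain ⟨w₀, hw₀⟩ : IsSquare ((u : ℤ_[2]) * (-21 - 48 * r + 8 * j)) :=
    padicInt_isSquare_of_toZModPow_three_eq_one (toZModPow_three_c₁ hu r j)
  set β : ℚ_[2] := (u : ℚ_[2]) * β₁ with hβ
  set w : ℚ_[2] := 2 * (w₀ : ℚ_[2]) with hw
  have hβ₁' : ((β₁ : ℚ_[2])) ^ 2 = 553 + 1344 * r := by
    have := congrArg ((↑) : ℤ_[2] → ℚ_[2]) hβ₁; push_cast at this; exact this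
  have hw₀' : ((u : ℚ_[2])) * (-21 - 48 * r + 8 * j) = (w₀ : ℚ_[2]) * w₀ := by
    have := congrArg ((↑) : ℤ_[2] → ℚ_[2]) hw₀; push_cast at this; exact this
  have hβj' : (β₁ : ℚ_[2]) = 3 + 16 * j := by rw [hβj]; push_cast; ring
  have hxβ : β ^ 2 = (C • V).a₄ := by rw [hB, hβ, mul_pow, hβ₁']
  have hwβ : w ^ 2 = (C • V).a₂ + 2 * β := by
    rw [hA, hβ, hw, hβj']; linear_combination (-4) * hw₀'
  have hβ0 : β ≠ 0 := by
    refine mul_ne_zero hu0 ?_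
    intro h0
    rw [PadicInt.coe_eq_zero] at h0
    have h1 := toZModPow_three_B₁ r
    rw [← hβ₁, h0, zero_pow two_ne_zero, map_zero] at h1
    exact absurd h1 (by decide)
  have hw0 : w ≠ 0 := by
    refine mul_ne_zero two_ne_zero ?_
    intro h0
    rw [PadicInt.coe_eq_zero] at h0
    have h1 := toZModPow_three_c₁ hu r j
    rw [hw₀, h0, mul_zero, map_zero] at h1
    exact absurd h1 (by decide)
  obtain ⟨hQ, h2Q⟩ := two_nsmul_eq_twoTorsionPoint_of_sq (C • V) hxβ hwβ hβ0 hw0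
  refine ⟨(VariableChange.pointEquiv V C).symm (.some β (β * w) hQ), ?_⟩
  apply (VariableChange.pointEquiv V C).injective
  rw [map_nsmul, AddEquiv.apply_symm_apply, h2Q, VariableChange.pointEquiv_some]
  simp only [twoTorsionPoint]
  congr 1 <;> simp [VariableChange.toX_def, VariableChange.toY_def, hC, hxm]

include ha hb in
/-- **`T₊` is NOT halvable for `u ≡ 3 (mod 8)`**: `x₊ − x₋ = us ≡ 3·5 ≡ 7 (mod 8)` is not a square in `ℚ₂`.
[cite: SilvermanTate2015, §3.5] [cite: Serre1973, Ch. II §3.3 Thm 4] -/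
theorem two_nsmul_ne_Tplus (hu : u % 8 = 3) {s r : ℤ_[2]} (hs : s ^ 2 = -7) (hsr : s = (53 : ℤ) + 128 * r)
    {hp : V.toAffine.Nonsingular ((-21 * (u : ℚ_[2]) + u * s) / 2) 0} (Q : V.toAffine.Point) :
    2 • Q ≠ .some _ 0 hp := by
  have hs' : ((s : ℚ_[2])) ^ 2 = -7 := by exact_mod_cast congrArg ((↑) : ℤ_[2] → ℚ_[2]) hs
  obtain ⟨hsum, hprod⟩ := roots_of_sq_eq V ha hb hs'
  obtain ⟨-, hrm⟩ := root_of_sum_prod V hsum hprod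
  refine two_nsmul_ne_of_not_isSquare_sub V (Or.inr hrm) ?_ Q
  rw [root_sub_root]
  have h := not_isSquare_coe_of_forall_sq_ne (z := (u : ℤ_[2]) * s) 3 (forall_sq_ne_toZModPow_three_us hu hsr)
  push_cast at h
  exact h

include ha hb in
/-- **Halves of `T₋` are not themselves halvable** (`u ≡ 3 (mod 8)`): if `2P = T₋` then `(x(P) − x₋)² = B = β²`, so
`x(P) = x₋ ± β ∈ {2u(−17 − 32r + 8j), −8u(5 + 8r + 2j)}` has odd valuation and is not a square — whereas `P = 2R`
would force `x(P) ∈ ℚ₂²`. Hence NO POINT OF ORDER `8`. [cite: SilvermanTate2015, §3.5] [cite: Serre1973, Ch. II §3.3 Thm 4] -/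
theorem not_two_nsmul_two_nsmul_eq_Tminus (hu : u % 8 = 3) {s r : ℤ_[2]} (hs : s ^ 2 = -7)
    (hsr : s = (53 : ℤ) + 128 * r) {hm : V.toAffine.Nonsingular ((-21 * (u : ℚ_[2]) - u * s) / 2) 0}
    (R : V.toAffine.Point) : 2 • (2 • R) ≠ .some _ 0 hm := by
  intro h
  obtain ⟨hx, hA, hB⟩ := smul_root_coeffs V ha hb hs hsr
  set xm : ℚ_[2] := (-21 * (u : ℚ_[2]) - u * s) / 2 with hxm
  set C : VariableChange ℚ_[2] := ⟨1, xm, 0, 0⟩ with hC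
  have hs' : ((s : ℚ_[2])) ^ 2 = -7 := by exact_mod_cast congrArg ((↑) : ℤ_[2] → ℚ_[2]) hs
  obtain ⟨hsum, hprod⟩ := roots_of_sq_eq V ha hb hs'
  obtain ⟨-, hrm⟩ := root_of_sum_prod V hsum hprod
  haveI : (C • V).IsTwoTorsionNF := isTwoTorsionNF_smul_of_root V (by linear_combination xm * hrm)
  rcases hP : (2 • R) with _ | ⟨x, y, hxy⟩
  · rw [hP, ← Affine.Point.zero_def, nsmul_zero] at h; exact Affine.Point.some_ne_zero _ h.symm
  rw [hP] at h
  have hxsq : IsSquare x := by simpa using isSquare_x_sub_of_two_nsmul_eq V (Or.inl rfl) hP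
  have h2 : 2 • (VariableChange.pointEquiv V C (.some x y hxy)) = (C • V).twoTorsionPoint := by
    rw [← map_nsmul, h, VariableChange.pointEquiv_some]
    simp only [twoTorsionPoint]
    congr 1 <;> simp [VariableChange.toX_def, VariableChange.toY_def, hC, hxm]
  rw [VariableChange.pointEquiv_some] at h2
  have hsq := sq_eq_a₄_of_two_nsmul_eq_twoTorsionPoint (C • V) h2
  have hX : C.toX x = x - xm := by rw [VariableChange.toX_def, hC]; simp
  rw [hX, hB] at hsq
  obtain ⟨β₁, j, hβ₁, hβj⟩ := exists_sqrt_B₁ r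
  have hβj' : (β₁ : ℚ_[2]) = 3 + 16 * j := by rw [hβj]; push_cast; ring
  have hβ₁' : ((β₁ : ℚ_[2])) ^ 2 = 553 + 1344 * r := by
    have := congrArg ((↑) : ℤ_[2] → ℚ_[2]) hβ₁; push_cast at this; exact this
  have hpm : (x - xm - u * β₁) * (x - xm + u * β₁) = 0 := by
    linear_combination hsq - (u : ℚ_[2]) ^ 2 * hβ₁'
  have hodd : Odd u := Int.odd_iff.mpr (by omega)
  have huU : IsUnit (u : ℤ_[2]) := by rw [PadicInt.isUnit_iff]; exact norm_intCast_eq_one_of_odd hodd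
  rcases mul_eq_zero.mp hpm with hcase | hcase
  · -- `x = xm + uβ₁ = 2·u(−17 + 2(−16r + 4j))`
    have hunit : IsUnit ((u : ℤ_[2]) * ((-17 : ℤ) + 2 * (-16 * r + 4 * j))) :=
      huU.mul (isUnit_intCast_add_two_mul (by decide) _)
    refine not_isSquare_two_zpow_mul_coe_of_isUnit (n := 1) odd_one hunit ?_
    have e : (2 : ℚ_[2]) ^ (1 : ℤ) * ((((u : ℤ_[2]) * ((-17 : ℤ) + 2 * (-16 * r + 4 * j)) : ℤ_[2]) : ℚ_[2])) = x := by
      rw [show x = xm + u * β₁ by linear_combination hcase, hx, hβj']; push_cast; ring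
    rw [e]; exact hxsq
  · -- `x = xm − uβ₁ = 8·u(−5 + 2(−4r − j))`
    have hunit : IsUnit ((u : ℤ_[2]) * ((-5 : ℤ) + 2 * (-4 * r - j))) :=
      huU.mul (isUnit_intCast_add_two_mul (by decide) _)
    refine not_isSquare_two_zpow_mul_coe_of_isUnit (n := 3) (by decide) hunit ?_
    have e : (2 : ℚ_[2]) ^ (3 : ℤ) * ((((u : ℤ_[2]) * ((-5 : ℤ) + 2 * (-4 * r - j)) : ℤ_[2]) : ℚ_[2])) = x := by
      rw [show x = xm - u * β₁ by linear_combination hcase, hx, hβj']; push_cast; ring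
    rw [e]; exact hxsq

end Family

end Summit.BirchSwinnertonDyer.BirchSwinnertonDyer.Theorems.PrintCf2.DyadicTorsion
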